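import Summits.NavierStokesRegularity.NavierStokesRegularity.Theses.ParabolicDriftLiouville

/-!
# `ParabolicDriftLiouville` — the parabolic decay hypothesis on `u` is load-bearing

Negative lemma (refuter, crux-attack at birth of `stmt-NavierStokesRegularity-19503`):
dropping the single hypothesis `∀ t < 0, ∀ x, ‖u t x‖ ≤ C / √(T - t)` from the crux
`Summit.NavierStokesRegularity.NavierStokesRegularity.Theses.ParabolicDriftLiouville.ParabolicDriftLiouville`
makes it false: the constant field `u ≡ e₀` with the zero drift `b ≡ 0` (`A = 0`, `T = 1`) is a
smooth divergence-free solution of the drifted KNSS mild identity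
(`e^{(t-s)Δ} e₀ = e₀`, `K(τ, z)[0, e₀] = 0`) which does not vanish.  So any proof of the crux must
use the decay of `u` (the only obstruction at `A = 0` is the constants, killed by the decay:
`Literature.Analysis.UnboundedOperators.heat_liouville_ancient`).  No positive route statement is
asserted here. [folklore]
-/

namespace Summit.NavierStokesRegularity.NavierStokesRegularity.Theorems.ParabolicDriftLiouville.Negative

open MeasureTheory Set

/-- A constant vector field is divergence free (its derivative vanishes). [folklore] -/
theorem isDivFree_const (c : EuclideanSpace ℝ (Fin 3)) :
    Literature.Analysis.FluidPDE.VectorCalculus.IsDivFree (fun _ : EuclideanSpace ℝ (Fin 3) => c) := by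
  intro x
  simp [Literature.Analysis.FluidPDE.VectorCalculus.divergence]

/-- **The decay hypothesis is load-bearing**: the crux `ParabolicDriftLiouville` with the single
hypothesis `∀ t < 0, ∀ x, ‖u t x‖ ≤ C / √(T - t)` DROPPED (everything else verbatim) is false,
witnessed by `b ≡ 0`, `u ≡ e₀` (`A = 0`, `T = 1`). [folklore] -/
theorem parabolicDriftLiouville_false_without_decay :
    ¬ (∀ (A T : ℝ) (b u : ℝ → EuclideanSpace ℝ (Fin 3) → EuclideanSpace ℝ (Fin 3)), 0 < T →
        ContDiffOn ℝ (⊤ : ℕ∞) (Function.uncurry b) (Set.Iio 0 ×ˢ Set.univ) →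
        (∀ t < 0, Literature.Analysis.FluidPDE.VectorCalculus.IsDivFree (b t)) →
        (∀ t < 0, ∀ x, ‖b t x‖ ≤ A / Real.sqrt (T - t)) →
        ContDiffOn ℝ (⊤ : ℕ∞) (Function.uncurry u) (Set.Iio 0 ×ˢ Set.univ) →
        (∀ t < 0, Literature.Analysis.FluidPDE.VectorCalculus.IsDivFree (u t)) →
        (∀ s t : ℝ, s < t → t < 0 → ∀ x, u t x =
          Literature.Analysis.FluidPDE.heatFlow (u s) (t - s) x -
            ∫ τ in Set.Ioo s t, ∫ y,
              Literature.Analysis.FluidPDE.oseenKernel (t - τ) (x - y) (b τ y) (u τ y)) →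
        ∀ t < 0, ∀ x, u t x = 0) := by
  intro h
  set e : EuclideanSpace ℝ (Fin 3) := EuclideanSpace.single 0 1 with he
  have hmild : ∀ s t : ℝ, s < t → t < 0 → ∀ x : EuclideanSpace ℝ (Fin 3),
      (fun (_ : ℝ) (_ : EuclideanSpace ℝ (Fin 3)) => e) t x =
        Literature.Analysis.FluidPDE.heatFlow ((fun (_ : ℝ) (_ : EuclideanSpace ℝ (Fin 3)) => e) s)
            (t - s) x -
          ∫ τ in Set.Ioo s t, ∫ y,
            Literature.Analysis.FluidPDE.oseenKernel (t - τ) (x - y)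
              ((fun (_ : ℝ) (_ : EuclideanSpace ℝ (Fin 3)) => (0 : EuclideanSpace ℝ (Fin 3))) τ y)
              ((fun (_ : ℝ) (_ : EuclideanSpace ℝ (Fin 3)) => e) τ y) := by
    intro s t hst _ x
    have hpos : 0 < t - s := sub_pos.2 hst
    simp only [Literature.Analysis.FluidPDE.oseenKernel_zero_left, integral_zero, sub_zero]
    rw [Literature.Analysis.FluidPDE.heatFlow_of_pos _ hpos,
      Literature.Analysis.UnboundedOperators.heatExtension_const _ hpos]
  have key := h 0 1 (fun _ _ => 0) (fun _ _ => e) one_pos contDiffOn_const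
    (fun _ _ => isDivFree_const 0) (fun _ _ _ => by simp) contDiffOn_const
    (fun _ _ => isDivFree_const e) hmild (-1) (by norm_num) 0
  have h0 : e 0 = 0 := by rw [key]; rfl
  simp [he] at h0

end Summit.NavierStokesRegularity.NavierStokesRegularity.Theorems.ParabolicDriftLiouville.Negative
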